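import Summits.RiemannHypothesis.RiemannHypothesis.Theorems.SoninPolyFrame050Check
import Summits.RiemannHypothesis.RiemannHypothesis.Theorems.SoninFrameBridge
import HarnessLib

/-!
# The `b = 1/2` four-vector Sonin-section certificate for `S = {∞, 2}`, III: `¬ SemilocalSoninIneqOn 2 a` for all `a > 1/2`

Cell `rh-explicit`, seat cc-s2-1 (lead R7-33 GO; the (Op-b)-type theorem of record for the semilocal operator
statement).  **Theorem** (`not_semilocalSoninIneqOn_two_of_gt_half`): for every `a > 1/2` the `S = {∞,2}`
Connes–Consani operator inequality `SemilocalSoninIneqOn 2 a` FAILS — superseding the abscissae `107/200`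
(cc-s2-3, `SoninCert.not_semilocalSoninIneqOn_two_of_gt`) and `(log 3)/2`.  Proof = the frame entry point
`SoninFrameBridge.not_semilocalSoninIneqOn_two_of_polyWitness_frame` (Ky-Fan relaxation + Gershgorin rows, NO Gram
inverse) fed with the data of file I: the window `G = polyWitness pH (1/2)` (CC's two moments vanish because
`pH = F″ + F′/2` with `F(±½) = F′(±½) = 0`), the four polynomial section vectors `η_i = polyEta (rH i) 12 ∈ evenPart ∩
vanishOn 1` (`SoninPolyEta`), their band energies (file I, `SoninPolyEps`), twisted traces (files I–II,
`SoninPolyTrace*`), the exact rational norms and twisted Gram entries decided HERE (`SoninPolyEta.plainIPQ/twistIPQ`,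
≈ 10 s each), and the rational inequalities `rows ≤ 1`, `C < Σ_i (B_i − K(2N_i+d_i)d_i)` (margin `1.234`).
STRUCTURE: `b = 1/2` is the first GENUINELY MULTI-VECTOR rung — no single vector of the polynomial section families
certifies there (best Ky-Fan ratio 0.88), four do.  No facts, no axioms.
-/

set_option linter.dupNamespace false  -- the mandated namespace repeats `RiemannHypothesis`

noncomputable section

open Summit.RiemannHypothesis.RiemannHypothesis.Theorems.SemilocalPolyWitness
open Summit.RiemannHypothesis.RiemannHypothesis.SoninCert (derivL)
open Summit.RiemannHypothesis.RiemannHypothesis.SoninPoly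
open Literature.Analysis.ValidatedNumerics Literature.Analysis.ValidatedNumerics.NumericsMP
open MeasureTheory
open scoped FourierTransform InnerProductSpace
open Literature.NumberTheory.LFunctions Literature.NumberTheory.ConnesConsani2021
open Summit.RiemannHypothesis.RiemannHypothesis

namespace Summit.RiemannHypothesis.RiemannHypothesis.SoninPoly.Frame050

/-- `0 ≤ 12`. [folklore] -/
theorem hX0 : (0 : ℚ) ≤ 12 := by norm_num

/-- The four section vectors as `L²` classes. [folklore] -/
def etaH (i : Fin 4) : Lp ℂ 2 (volume : Measure ℝ) := polyEta (rH i) hX0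

/-- The band energies (file I). [folklore] -/
theorem eps_le (i : Fin 4) :
    ∫ x in Set.Icc (-1 : ℝ) 1, ‖((𝓕 (etaH i) : Lp ℂ 2 (volume : Measure ℝ)) : ℝ → ℂ) x‖ ^ 2 ≤ ((epsH i : ℚ) : ℝ) := by
  fin_cases i
  · exact integral_norm_sq_lpFourier_polyEta_le rH0 hX0 (by norm_num) epsCheck0
  · exact integral_norm_sq_lpFourier_polyEta_le rH1 hX0 (by norm_num) epsCheck1
  · exact integral_norm_sq_lpFourier_polyEta_le rH2 hX0 (by norm_num) epsCheck2
  · exact integral_norm_sq_lpFourier_polyEta_le rH3 hX0 (by norm_num) epsCheck3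

/-- The twisted traces (files I–II). [folklore] -/
theorem B_le (i : Fin 4) : ((BH i : ℚ) : ℝ) ≤ (soninTraceForm (twistKernel 2
      (weilConv (polyWitness cH.p cH.b) (weilReflect (polyWitness cH.p cH.b)))) (etaH i : ℝ → ℂ)).re := by
  fin_cases i
  · exact re_soninTraceForm_polyEta_ge_of_check (r := rH0) hX0 qtabCheck traceCheck0
  · exact re_soninTraceForm_polyEta_ge_of_check (r := rH1) hX0 qtabCheck traceCheck1
  · exact re_soninTraceForm_polyEta_ge_of_check (r := rH2) hX0 qtabCheck traceCheck2
  · exact re_soninTraceForm_polyEta_ge_of_check (r := rH3) hX0 qtabCheck traceCheck3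

set_option maxHeartbeats 0 in  -- kernel evaluation of one exact rational norm; no search
/-- `0 ≤ N_1 ∧ plainIPQ r_1 r_1 12 ≤ N_1²`. [folklore] -/
theorem normCheck0 : 0 ≤ NH 0 ∧ plainIPQ rH0 rH0 12 ≤ NH 0 ^ 2 := by
  constructor <;> decide +kernel

set_option maxHeartbeats 0 in  -- kernel evaluation of one exact rational norm; no search
/-- `0 ≤ N_2 ∧ plainIPQ r_2 r_2 12 ≤ N_2²`. [folklore] -/
theorem normCheck1 : 0 ≤ NH 1 ∧ plainIPQ rH1 rH1 12 ≤ NH 1 ^ 2 := by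
  constructor <;> decide +kernel

set_option maxHeartbeats 0 in  -- kernel evaluation of one exact rational norm; no search
/-- `0 ≤ N_3 ∧ plainIPQ r_3 r_3 12 ≤ N_3²`. [folklore] -/
theorem normCheck2 : 0 ≤ NH 2 ∧ plainIPQ rH2 rH2 12 ≤ NH 2 ^ 2 := by
  constructor <;> decide +kernel

set_option maxHeartbeats 0 in  -- kernel evaluation of one exact rational norm; no search
/-- `0 ≤ N_4 ∧ plainIPQ r_4 r_4 12 ≤ N_4²`. [folklore] -/
theorem normCheck3 : 0 ≤ NH 3 ∧ plainIPQ rH3 rH3 12 ≤ NH 3 ^ 2 := by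
  constructor <;> decide +kernel

/-- The norm budgets. [folklore] -/
theorem norm_checks (i : Fin 4) : 0 ≤ NH i ∧ plainIPQ (rH i) (rH i) 12 ≤ NH i ^ 2 := by
  fin_cases i
  · exact normCheck0
  · exact normCheck1
  · exact normCheck2
  · exact normCheck3

/-- `‖η_i‖ ≤ N_i`. [folklore] -/
theorem norm_le (i : Fin 4) : ‖etaH i‖ ≤ ((NH i : ℚ) : ℝ) :=
  norm_polyEta_le (rH i) hX0 (by norm_num) (norm_checks i).1 (norm_checks i).2

set_option maxHeartbeats 0 in  -- kernel evaluation of one exact rational twisted Gram entry; no search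
/-- `|twistIPQ r_1 r_1 12| ≤ Gb_11`. [folklore] -/
theorem gramCheck00 : |twistIPQ rH0 rH0 12| ≤ GbH 0 0 := by
  decide +kernel

set_option maxHeartbeats 0 in  -- kernel evaluation of one exact rational twisted Gram entry; no search
/-- `|twistIPQ r_1 r_2 12| ≤ Gb_12`. [folklore] -/
theorem gramCheck01 : |twistIPQ rH0 rH1 12| ≤ GbH 0 1 := by
  decide +kernel

set_option maxHeartbeats 0 in  -- kernel evaluation of one exact rational twisted Gram entry; no search
/-- `|twistIPQ r_1 r_3 12| ≤ Gb_13`. [folklore] -/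
theorem gramCheck02 : |twistIPQ rH0 rH2 12| ≤ GbH 0 2 := by
  decide +kernel

set_option maxHeartbeats 0 in  -- kernel evaluation of one exact rational twisted Gram entry; no search
/-- `|twistIPQ r_1 r_4 12| ≤ Gb_14`. [folklore] -/
theorem gramCheck03 : |twistIPQ rH0 rH3 12| ≤ GbH 0 3 := by
  decide +kernel

set_option maxHeartbeats 0 in  -- kernel evaluation of one exact rational twisted Gram entry; no search
/-- `|twistIPQ r_2 r_1 12| ≤ Gb_21`. [folklore] -/
theorem gramCheck10 : |twistIPQ rH1 rH0 12| ≤ GbH 1 0 := by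
  decide +kernel

set_option maxHeartbeats 0 in  -- kernel evaluation of one exact rational twisted Gram entry; no search
/-- `|twistIPQ r_2 r_2 12| ≤ Gb_22`. [folklore] -/
theorem gramCheck11 : |twistIPQ rH1 rH1 12| ≤ GbH 1 1 := by
  decide +kernel

set_option maxHeartbeats 0 in  -- kernel evaluation of one exact rational twisted Gram entry; no search
/-- `|twistIPQ r_2 r_3 12| ≤ Gb_23`. [folklore] -/
theorem gramCheck12 : |twistIPQ rH1 rH2 12| ≤ GbH 1 2 := by
  decide +kernel

set_option maxHeartbeats 0 in  -- kernel evaluation of one exact rational twisted Gram entry; no search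
/-- `|twistIPQ r_2 r_4 12| ≤ Gb_24`. [folklore] -/
theorem gramCheck13 : |twistIPQ rH1 rH3 12| ≤ GbH 1 3 := by
  decide +kernel

set_option maxHeartbeats 0 in  -- kernel evaluation of one exact rational twisted Gram entry; no search
/-- `|twistIPQ r_3 r_1 12| ≤ Gb_31`. [folklore] -/
theorem gramCheck20 : |twistIPQ rH2 rH0 12| ≤ GbH 2 0 := by
  decide +kernel

set_option maxHeartbeats 0 in  -- kernel evaluation of one exact rational twisted Gram entry; no search
/-- `|twistIPQ r_3 r_2 12| ≤ Gb_32`. [folklore] -/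
theorem gramCheck21 : |twistIPQ rH2 rH1 12| ≤ GbH 2 1 := by
  decide +kernel

set_option maxHeartbeats 0 in  -- kernel evaluation of one exact rational twisted Gram entry; no search
/-- `|twistIPQ r_3 r_3 12| ≤ Gb_33`. [folklore] -/
theorem gramCheck22 : |twistIPQ rH2 rH2 12| ≤ GbH 2 2 := by
  decide +kernel

set_option maxHeartbeats 0 in  -- kernel evaluation of one exact rational twisted Gram entry; no search
/-- `|twistIPQ r_3 r_4 12| ≤ Gb_34`. [folklore] -/
theorem gramCheck23 : |twistIPQ rH2 rH3 12| ≤ GbH 2 3 := by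
  decide +kernel

set_option maxHeartbeats 0 in  -- kernel evaluation of one exact rational twisted Gram entry; no search
/-- `|twistIPQ r_4 r_1 12| ≤ Gb_41`. [folklore] -/
theorem gramCheck30 : |twistIPQ rH3 rH0 12| ≤ GbH 3 0 := by
  decide +kernel

set_option maxHeartbeats 0 in  -- kernel evaluation of one exact rational twisted Gram entry; no search
/-- `|twistIPQ r_4 r_2 12| ≤ Gb_42`. [folklore] -/
theorem gramCheck31 : |twistIPQ rH3 rH1 12| ≤ GbH 3 1 := by
  decide +kernel

set_option maxHeartbeats 0 in  -- kernel evaluation of one exact rational twisted Gram entry; no search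
/-- `|twistIPQ r_4 r_3 12| ≤ Gb_43`. [folklore] -/
theorem gramCheck32 : |twistIPQ rH3 rH2 12| ≤ GbH 3 2 := by
  decide +kernel

set_option maxHeartbeats 0 in  -- kernel evaluation of one exact rational twisted Gram entry; no search
/-- `|twistIPQ r_4 r_4 12| ≤ Gb_44`. [folklore] -/
theorem gramCheck33 : |twistIPQ rH3 rH3 12| ≤ GbH 3 3 := by
  decide +kernel

/-- The twisted-Gram budgets: `|twistIPQ r_i r_j 12| ≤ Gb_ij`. [folklore] -/
theorem gram_checks (i j : Fin 4) : |twistIPQ (rH i) (rH j) 12| ≤ GbH i j := by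
  fin_cases i <;> fin_cases j
  · exact gramCheck00
  · exact gramCheck01
  · exact gramCheck02
  · exact gramCheck03
  · exact gramCheck10
  · exact gramCheck11
  · exact gramCheck12
  · exact gramCheck13
  · exact gramCheck20
  · exact gramCheck21
  · exact gramCheck22
  · exact gramCheck23
  · exact gramCheck30
  · exact gramCheck31
  · exact gramCheck32
  · exact gramCheck33

/-- `‖⟪θ₂η_i, θ₂η_j⟫‖ ≤ Gb_ij`. [folklore] -/
theorem gram_le (i j : Fin 4) : ‖⟪primeTwist 2 (etaH i), primeTwist 2 (etaH j)⟫_ℂ‖ ≤ ((GbH i j : ℚ) : ℝ) :=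
  norm_inner_primeTwist_polyEta_le (rH i) (rH j) hX0 (by norm_num) (gram_checks i j)

/-- The rational side conditions of the window record and the frame inequalities (all `decide`). [folklore] -/
theorem side_checks :
    0 < cH.b ∧ cH.b ≤ 1 ∧ cH.b < logTwoLo20 ∧ logTwoHi20 ≤ 2 * cH.b ∧ 0 < cH.nA ∧ 0 < cH.nt ∧
    (incrementL cH.p cH.b).headD 0 = 0 ∧ invPartialExpQ cH.nt (2 * (2 * cH.b)) < 1 ∧
    LQ.evQ (derivL FH) cH.b = 0 ∧ LQ.evQ (derivL FH) (-cH.b) = 0 ∧ LQ.evQ FH cH.b = 0 ∧ LQ.evQ FH (-cH.b) = 0 ∧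
    (3 / 2 + 141422 / 100000) * (2 * cH.b) * LQ.normSq cH.p cH.b < KH ∧
    (∀ i : Fin 4, epsH i * 10000000 / 572 ≤ dH i ^ 2) ∧ (∀ i : Fin 4, 0 ≤ dH i) ∧
    (∀ i : Fin 4, ∑ j, (GbH i j + 4 * (dH i * (NH j + dH j) + NH i * dH j)) ≤ 1) ∧
    CH < ∑ i, (BH i - KH * ((2 * NH i + dH i) * dH i)) := by
  refine ⟨by decide +kernel, by decide +kernel, by decide +kernel, by decide +kernel, by decide +kernel, by decide +kernel,
    by decide +kernel, by decide +kernel, by decide +kernel, by decide +kernel, by decide +kernel, by decide +kernel,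
    by decide +kernel, by decide +kernel, by decide +kernel, by decide +kernel, by decide +kernel⟩

set_option maxHeartbeats 0 in  -- kernel evaluation of cc-s2-4's archimedean majorant lhsQ; no search
/-- The Weil-side budget: `lhsQ − c₂♯‖G‖² < C`. [folklore] -/
theorem weil_check : cH.lhsQ - c2SharpQ * LQ.normSq cH.p cH.b < CH := by
  decide +kernel

/-- **THEOREM (b = 1/2 rung of the semilocal operator statement, S = {∞, 2}).**  For every `a > 1/2` the
Connes–Consani-type operator inequality `SemilocalSoninIneqOn 2 a` fails: a four-vector polynomial Sonin section
against the window `(F″ + F′/2)·1_{[−1/2,1/2]}` violates it (exact rational certificate, margin `1.234`). [folklore] -/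
theorem not_semilocalSoninIneqOn_two_of_gt_half {a : ℝ} (ha : (1 / 2 : ℝ) < a) : ¬ SemilocalSoninIneqOn 2 a := by
  obtain ⟨hb0, hb1, hblog, h2b, hnA, hnt, hhead, htail1, hF1, hF2, hF3, hF4, hK, hdε, hd0, hrow, hineq⟩ := side_checks
  have ha' : ((cH.b : ℚ) : ℝ) < a := by show (((1 / 2 : ℚ)) : ℝ) < a; push_cast; linarith
  exact not_semilocalSoninIneqOn_two_of_polyWitness_frame cH (F := FH) hb0 hb1 hblog h2b hnA hnt hhead htail1 rfl
    hF1 hF2 hF3 hF4 weil_check hK (η := etaH) (fun i => polyEta_mem_evenPart (rH i) hX0)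
    (fun i => polyEta_mem_vanishOn (rH i) hX0) eps_le hdε hd0 norm_le B_le gram_le hrow hineq ha'

/-- The same with the abscissa as a rational literal. [folklore] -/
theorem not_semilocalSoninIneqOn_two_of_gt_half' {a : ℝ} (ha : ((1 / 2 : ℚ) : ℝ) < a) : ¬ SemilocalSoninIneqOn 2 a :=
  not_semilocalSoninIneqOn_two_of_gt_half (by push_cast at ha; linarith)

end Summit.RiemannHypothesis.RiemannHypothesis.SoninPoly.Frame050

end
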